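import Summits.NavierStokesRegularity.NavierStokesRegularity.Theorems.ScaledTopAlignmentGigaMiuraTypeI
import Summits.NavierStokesRegularity.NavierStokesRegularity.Theses.ScaledTopAlignment
import HarnessLib

/-!
# Route `ScaledTopAlignment`: the support binder GAP‴ = `TypeIParabolicZoomLimit`
# (stmt-NavierStokesRegularity-19596) is a THEOREM, by name

The route's deciding theorem (rev 9–10, planner p3 g3) is
`closes (hW : AprioriWindowBulkAlignment) (hZ : TypeIParabolicZoomLimit) (hII : NoTypeII) : NavierStokesRegularity`.
Its binder `TypeIParabolicZoomLimit` (GAP‴) is VERBATIM the conclusion of the tree theorem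
`Theorems.typeIZoom_ancientMild_limit_parabolic` (file `ScaledTopAlignmentGigaMiuraTypeI`, p420720): at a Type-I
blow-up time `T` of a classical Leray–Hopf solution with slab bounds and no smooth extension past `T`, the Type-I zoom
about Leray near-maximum points (KNSS 2009 §6 rescaling + the tree's `C¹_loc` compactness) has a non-trivial Type-I
ancient mild limit `W` (`W(−1,0) ≠ 0`), and every slice vorticity `curl W(s)`, `s < 0`, is the pointwise limit of
vorticity zooms `(λ_j²/ν) ω(t_j, x_j + λ_j ·)` whose data obey the PARABOLIC LAW `λ_j²(−s) = ν(T − t_j)`, `t_j → T`.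
WHAT THIS IS NOT: not NS regularity — it closes a support binder; the route's open mathematics is the a-priori door
W3ʷᵇ (stmt-19447) and the residual NoTypeII (stmt-0056).

References: Koch–Nadirashvili–Seregin–Šverák, Acta Math. 203 (2009) 83–105, §6 (Lemma 6.1, proof of Thm 6.2)
[KochNadirashviliSereginSverak2009]; Giga–Miura, CMP 303 (2011) = HUPS #956, §2.1 [GigaMiura2011].
-/

noncomputable section

-- the summit and its single sub-problem share the name (CONVENTIONS §1), as in every Theorems file
set_option linter.dupNamespace false

namespace Summit.NavierStokesRegularity.NavierStokesRegularity.Theorems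

/-- **GAP‴ (`TypeIParabolicZoomLimit`, stmt-NavierStokesRegularity-19596) holds**, by name: it is the statement of
`typeIZoom_ancientMild_limit_parabolic`. [cite: KochNadirashviliSereginSverak2009, §6 Lemma 6.1 and proof of
Thm 6.2 (Acta Math. 203 pp. 98–101)] -/
theorem scaledTopAlignment_typeIParabolicZoomLimit_proof :
    Summit.NavierStokesRegularity.NavierStokesRegularity.Theses.ScaledTopAlignment.TypeIParabolicZoomLimit := by
  intro ν T hν hT u p hsol hLH hslab hI hext
  exact typeIZoom_ancientMild_limit_parabolic hν hT hsol hLH hslab hI hext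

end Summit.NavierStokesRegularity.NavierStokesRegularity.Theorems

end
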